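import Summits.Parity.BatemanHorn.Theses.VanishingDimension

/-!
# Crux `TiltedLevel` (stmt-Parity-18603) — strategy census, part B: typed signatures

Second strategist workfile (planner-cstrat-stmt-Parity-18603-b1-0, 2026-08-17). NOT route items,
NOT a skeleton line: these are the Lean signatures referred to in `STRATEGY-CENSUS.md`, Part B
(sections Strengthen / Decomposition), checked to elaborate against the route file
`Summits/Parity/BatemanHorn/Theses/VanishingDimension.lean`. Part A's signatures are in the sibling
workfile `CensusSignatures.lean` (strategist s1); `TiltedLevelAt` is restated here verbatim so that
this file imports only the (built) route file.

* `TiltedLevelInner k f θ z` — the crux body at one system, one level `θ`, one tilt `z` (the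
  `=o[atTop]` relation itself); `TiltedLevelAt`, `tiltedLevel_iff` (by `rfl`).
* Decomposition by MODULUS TYPE: `TiltedLevelOn P k f θ z` — the same `ℓ¹` law with the outer sum
  restricted to squarefree moduli `d` satisfying `P d`; `PrimeModuliLaw` (`P = Nat.Prime`: the
  parity-BLIND piece — Selberg's twisted host passes it — yet relative-Bateman–Horn-hard on average
  over the derived family, census Part B (F1′)) and `CompositeModuliLaw` (`P = ¬ Nat.Prime`, incl.
  the vanishing `d = 1` term: the parity-TIGHT piece, census (F2)); the glue at equal `(θ, z)` is the
  theorem `tiltedLevelInner_of_prime_of_composite` (PROVED: `Finset.sum_filter_add_sum_filter_not`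
  + `IsLittleO.add`), and `PrimeCompositeGlue` records the `∃θ ∃z₀`-level implication (true by the
  downward monotonicity of the law in `θ`, not proved here because the split is not filed).
* Strengthen: `PBlindClassLaw k f θ z` — at every prime modulus `p < x^θ`, the `p`-BLIND weight
  `W_p(n) = z^{Σ_i ω_{≠p}(f_i(n))}` is distributed over ALL classes `s mod p` according to the size
  factors `σ_p(s;x)` alone, in `ℓ¹` relative to `A₁V`; it contains `PrimeModuliLaw` (root classes:
  `A(x;p,r) = z^{cnt(p,r)} Σ_{n ≡ r} W_p(n)` exactly) and by Plancherel on `ℤ/p` is a bound for the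
  twisted sums `Σ_n W_p(n) e(an/p)`, `a ≠ 0`, whose Type-I part vanishes identically (census §B.2).
-/

namespace Summit.Parity.BatemanHorn.Cruxes.TiltedLevel.CensusB

open scoped BigOperators Classical
open Filter Asymptotics Finset Polynomial

/-- The crux body at one system `(k,f)`, one level `θ` and one tilt `z`: the `=o` relation of
`TiltedLevel` with every `let` copied verbatim. -/
def TiltedLevelInner (k : ℕ) (f : Fin k → Polynomial ℤ) (θ z : ℝ) : Prop :=
  let w : ℕ → ℝ := fun n => z ^ (∑ i, ArithmeticFunction.cardDistinctFactors (((f i).eval (n : ℤ)).toNat)); let A : ℕ → ℕ → ℕ → ℝ := fun x d r => ∑ n ∈ (Finset.Icc 1 x).filter (fun n : ℕ => n ≡ r [MOD d]), w n; let cnt : ℕ → ℕ → ℕ := fun p s => (Finset.univ.filter (fun i => (p : ℤ) ∣ (f i).eval (s : ℤ))).card; let m : ℕ → ℝ := fun p => ∑ s ∈ Finset.range p, z ^ cnt p s; let g : ℕ → ℕ → ℝ := fun d r => ∏ p ∈ d.primeFactors, z ^ cnt p r / m p; let S : ℕ → ℕ → ℕ → ℝ := fun x d r => ∏ i, (1 -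 (∑ p ∈ d.primeFactors.filter (fun p : ℕ => (p : ℤ) ∣ (f i).eval (r : ℤ)), Real.log p) / (((f i).natDegree : ℝ) * Real.log x)) ^ (z - 1); let V : ℕ → ℝ := fun x => ∏ p ∈ (Finset.range ⌊(x : ℝ) ^ θ⌋₊).filter Nat.Prime, ((p : ℝ) - Literature.NumberTheory.Sieve.polyRootCountMod f p) / m p; (fun x : ℕ => ∑ d ∈ (Finset.Icc 1 ⌊(x : ℝ) ^ θ⌋₊).filter Squarefree, ∑ r ∈ (Finset.range d).filter (fun r : ℕ => (d : ℤ) ∣ ∏ i, (f i).eval (r : ℤ)), |A x d r - g d r * S x d r * ∑ n ∈ Finset.Icc 1 x, w n|) =o[atTop] fun x : ℕ => (∑ n ∈ Finset.Icc 1 x, w n) * V x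

/-- The crux `TiltedLevel` with the system `(k, f)` fixed. -/
def TiltedLevelAt (k : ℕ) (f : Fin k → Polynomial ℤ) : Prop :=
  ∃ θ : ℝ, 0 < θ ∧ θ ≤ 1 / 4 ∧ ∃ z₀ : ℝ, 0 < z₀ ∧ ∀ z : ℝ, 0 < z → z < z₀ → TiltedLevelInner k f θ z

/-- `TiltedLevel` is literally `∀ systems, TiltedLevelAt` (definitional). -/
theorem tiltedLevel_iff :
    Summit.Parity.BatemanHorn.Theses.VanishingDimension.TiltedLevel ↔
      ∀ (k : ℕ) (f : Fin k → Polynomial ℤ),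
        Literature.NumberTheory.Sieve.IsBatemanHornSystem f → TiltedLevelAt k f := by
  rfl

/-! ## Decomposition by modulus type: prime moduli ∣ composite moduli -/

/-- The `ℓ¹` law of the crux with the outer sum restricted to the squarefree moduli `d ≤ x^θ`
satisfying `P d` (same classes, same model `g·S·A₁`, same normalisation `A₁V`). -/
def TiltedLevelOn (P : ℕ → Prop) [DecidablePred P] (k : ℕ) (f : Fin k → Polynomial ℤ) (θ z : ℝ) : Prop :=
  let w : ℕ → ℝ := fun n => z ^ (∑ i, ArithmeticFunction.cardDistinctFactors (((f i).eval (n : ℤ)).toNat)); let A : ℕ → ℕ → ℕ → ℝ := fun x d r => ∑ n ∈ (Finset.Icc 1 x).filter (fun n : ℕ => n ≡ r [MOD d]), w n; let cnt : ℕ → ℕ → ℕ := fun p s => (Finset.univ.filter (fun i => (p : ℤ) ∣ (f i).eval (s : ℤ))).card; let m : ℕ → ℝ := fun p => ∑ s ∈ Finset.range p, z ^ cnt p s; let g : ℕ → ℕ → ℝ := fun d r => ∏ p ∈ d.primeFactors, z ^ cnt p r / m p; let S : ℕ → ℕ → ℕ → ℝ := fun x d r => ∏ i, (1 - (∑ p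 ∈ d.primeFactors.filter (fun p : ℕ => (p : ℤ) ∣ (f i).eval (r : ℤ)), Real.log p) / (((f i).natDegree : ℝ) * Real.log x)) ^ (z - 1); let V : ℕ → ℝ := fun x => ∏ p ∈ (Finset.range ⌊(x : ℝ) ^ θ⌋₊).filter Nat.Prime, ((p : ℝ) - Literature.NumberTheory.Sieve.polyRootCountMod f p) / m p; (fun x : ℕ => ∑ d ∈ ((Finset.Icc 1 ⌊(x : ℝ) ^ θ⌋₊).filter Squarefree).filter (fun d : ℕ => P d), ∑ r ∈ (Finset.range d).filter (fun r : ℕ => (d : ℤ) ∣ ∏ i, (f i).eval (r : ℤ)), |A x d r - g d r * S x d r * ∑ n ∈ Finset.Icc 1 x, w n|) =o[atTop] fun x : ℕ => (∑ n ∈ Finset.Icc 1 x, w n) * V x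

/-- GLUE at equal `(θ, z)`: the prime-moduli law and the composite-moduli law give the crux body
(the outer sum splits by `Finset.sum_filter_add_sum_filter_not`, then `IsLittleO.add`). -/
theorem tiltedLevelInner_of_prime_of_composite (k : ℕ) (f : Fin k → Polynomial ℤ) (θ z : ℝ)
    (hP : TiltedLevelOn Nat.Prime k f θ z) (hC : TiltedLevelOn (fun d : ℕ => ¬ d.Prime) k f θ z) :
    TiltedLevelInner k f θ z := by
  dsimp only [TiltedLevelOn, TiltedLevelInner] at hP hC ⊢
  refine (hP.add hC).congr_left ?_
  intro x
  exact Finset.sum_filter_add_sum_filter_not _ _ _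

/-- `PrimeModuliLaw`: the crux restricted to PRIME moduli `p < x^θ` (parity-BLIND: Selberg's
twisted tilted host `z^{Σω}(1 + λ(∏ f_i(n)))` passes it, its per-class deviations being of relative
order `(log x)^{-2κ}` and the `g`-mass of the primes only `≍ κ log log x`; yet relative
Bateman–Horn-hard on average over the derived family `f(r + pt)/p^v`, census Part B (F1′)). -/
def PrimeModuliLaw (k : ℕ) (f : Fin k → Polynomial ℤ) : Prop :=
  ∃ θ : ℝ, 0 < θ ∧ θ ≤ 1 / 4 ∧ ∃ z₀ : ℝ, 0 < z₀ ∧ ∀ z : ℝ, 0 < z → z < z₀ →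
    TiltedLevelOn Nat.Prime k f θ z

/-- `CompositeModuliLaw`: the crux restricted to NON-prime squarefree moduli `d ≤ x^θ` (the
`d = 1` term vanishes identically). Parity-TIGHT: here the twisted host deviates by `≍ A₁V` in
aggregate (census (F2)), and every single class is as hard as a prime-modulus class. -/
def CompositeModuliLaw (k : ℕ) (f : Fin k → Polynomial ℤ) : Prop :=
  ∃ θ : ℝ, 0 < θ ∧ θ ≤ 1 / 4 ∧ ∃ z₀ : ℝ, 0 < z₀ ∧ ∀ z : ℝ, 0 < z → z < z₀ →
    TiltedLevelOn (fun d : ℕ => ¬ d.Prime) k f θ z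

/-- Same-parameter form of the split (both pieces at one `θ`, one `z₀`) implies the crux at the
system — immediate from `tiltedLevelInner_of_prime_of_composite`. -/
theorem tiltedLevelAt_of_sameLevel (k : ℕ) (f : Fin k → Polynomial ℤ)
    (h : ∃ θ : ℝ, 0 < θ ∧ θ ≤ 1 / 4 ∧ ∃ z₀ : ℝ, 0 < z₀ ∧ ∀ z : ℝ, 0 < z → z < z₀ →
      TiltedLevelOn Nat.Prime k f θ z ∧ TiltedLevelOn (fun d : ℕ => ¬ d.Prime) k f θ z) :
    TiltedLevelAt k f := by
  obtain ⟨θ, hθ, hθ', z₀, hz₀, H⟩ := h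
  exact ⟨θ, hθ, hθ', z₀, hz₀, fun z hz hzz =>
    tiltedLevelInner_of_prime_of_composite k f θ z (H z hz hzz).1 (H z hz hzz).2⟩

/-- The `∃θ ∃z₀`-level glue `PrimeModuliLaw → CompositeModuliLaw → TiltedLevelAt` (true: the law is
downward monotone in `θ` — the left side loses non-negative terms and `V` only gains factors `< 1`
— so both pieces hold at `min θ₁ θ₂`, `min z₀ z₀'`); recorded as a Prop, the split is NOT filed
(census Part B §Decomposition: both pieces are open-problem-hard, no movement for provers). -/
def PrimeCompositeGlue : Prop :=
  ∀ (k : ℕ) (f : Fin k → Polynomial ℤ), PrimeModuliLaw k f → CompositeModuliLaw k f → TiltedLevelAt k f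

/-! ## Strengthen: the `p`-blind all-classes law at prime moduli -/

/-- STRENGTHEN `S₂` (all classes, `p`-blind weight). For every prime `p < x^θ` put
`W_p(n) = z^{Σ_i #(primeFactors(f_i(n)) ∖ {p})}` (the tilt with the prime `p` ignored) and the pure
size factor `σ_p(s;x) = ∏_i (1 − [p ∣ f_i(s)]·log p/(deg f_i · log x))^{z−1}`; then the `W_p`-mass of
EVERY class `s mod p` is the fraction `σ_p(s;x)/Σ_{s'} σ_p(s';x)` of the total `W_p`-mass, in `ℓ¹`
over `p < x^θ` and `s mod p`, with error `o(A₁V)` (`A₁`, `V` of the crux). On root classes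
`A(x;p,r) = z^{cnt(p,r)}·Σ_{n ≡ r (p)} W_p(n)` identically, so `S₂` contains `PrimeModuliLaw` up to
the `O(1/log x)` discrepancy between `Σ_s z^{cnt}σ` and `m_p`; by Plancherel on `ℤ/p` it is
equivalent to `Σ_p (1/p)Σ_{a≠0} |Σ_n W_p(n)e(an/p) − (model)|²`-control, and the Type-I part of each
twisted sum VANISHES identically (census Part B §Strengthen: what is left is the deep range). -/
def PBlindClassLaw (k : ℕ) (f : Fin k → Polynomial ℤ) (θ z : ℝ) : Prop :=
  let w : ℕ → ℝ := fun n => z ^ (∑ i, ArithmeticFunction.cardDistinctFactors (((f i).eval (n : ℤ)).toNat)); let Wp : ℕ → ℕ → ℝ := fun p n => z ^ (∑ i, ((((f i).eval (n : ℤ)).toNat.primeFactors).erase p).card); let cnt : ℕ → ℕ → ℕ := fun p s => (Finset.univ.filter (fun i => (p : ℤ) ∣ (f i).eval (s : ℤ))).card; let m : ℕ → ℝ := fun p => ∑ s ∈ Finset.range p, z ^ cnt p s; let σ : ℕ → ℕ → ℕ → ℝ := fun x p s => ∏ i, (1 - (if (p : ℤ) ∣ (f i).eval (s : ℤ) then Real.log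 p else 0) / (((f i).natDegree : ℝ) * Real.log x)) ^ (z - 1); let V : ℕ → ℝ := fun x => ∏ p ∈ (Finset.range ⌊(x : ℝ) ^ θ⌋₊).filter Nat.Prime, ((p : ℝ) - Literature.NumberTheory.Sieve.polyRootCountMod f p) / m p; (fun x : ℕ => ∑ p ∈ (Finset.range ⌊(x : ℝ) ^ θ⌋₊).filter Nat.Prime, ∑ s ∈ Finset.range p, |(∑ n ∈ (Finset.Icc 1 x).filter (fun n : ℕ => n ≡ s [MOD p]), Wp p n) - σ x p s / (∑ s' ∈ Finset.range p, σ x p s') * ∑ n ∈ Finset.Icc 1 x, Wp p n|) =o[atTop] fun x : ℕ => (∑ n ∈ Finset.Icc 1 x, w n) * V x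

/-- `S₂` for a system: some level and tilt threshold. -/
def PBlindClassLawAt (k : ℕ) (f : Fin k → Polynomial ℤ) : Prop :=
  ∃ θ : ℝ, 0 < θ ∧ θ ≤ 1 / 4 ∧ ∃ z₀ : ℝ, 0 < z₀ ∧ ∀ z : ℝ, 0 < z → z < z₀ → PBlindClassLaw k f θ z

/-- `S₂ → PrimeModuliLaw` (root classes are classes; the model discrepancy is `O(1/log x)` relative,
summable against the prime `g`-mass `κ log log x` inside `o(A₁V)` for `2κ < 1`); recorded as a Prop,
not proved in this census file. -/
def PBlindImpliesPrimeModuli : Prop :=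
  ∀ (k : ℕ) (f : Fin k → Polynomial ℤ), PBlindClassLawAt k f → PrimeModuliLaw k f

end Summit.Parity.BatemanHorn.Cruxes.TiltedLevel.CensusB
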